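import Literature.Analysis.FluidPDE.AxisymQuotientEquationsOmega
import Literature.Analysis.FluidPDE.HouLeiLiEstimate
import HarnessLib

/-!
# The `L²` energy inequality of `Ω = ω^θ/r` (Lei–Zhang 2017, §3, the `Ω`-half of (3.1)–(3.3))

Analysis/FluidPDE proof file (theorems only; no definitions, no named facts), sequel of
`AxisymQuotientEquationsOmega.lean`, on the discharge path of the named facts
`Literature.Analysis.FluidPDE.LeiZhang2017_logModulus_regularity`,
`…LeiZhang2017_smallSwirl_regularity` and `…Wei2016_logModulus_regularity`.

Lei–Zhang (arXiv:1505.02628, §3, p. 8) pair the equation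
`∂ₜΩ + (b·∇)Ω = (Δ + (2/r)∂ᵣ)Ω − 2(v^θ/r)J` with `Ω` over `ℝ³`:

> "`½ d/dt ∫ |Ω|² + ∫ |∇Ω|² + ∫ |Ω(t,0,z)|² dz = −2 ∫ (v^θ/r) J Ω`
> … here we used the identity `∫ Ω (Δ + (2/r)∂ᵣ) Ω = −‖∇Ω‖² − ∫ |Ω(t,0,z)|² dz`
> and the transport term vanishes since `b` is divergence-free."

This file proves the fixed-time form of this inequality, with whole-space integrations by parts
under square-integrability hypotheses (no cut-offs), in three layers:

* `integral_mul_fderiv_apply_eq_zero_of_isDivFree` — **the transport term vanishes**: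
  `∫ G · DG[b] = 0` for `G ∈ C¹`, `G, ∂ᵢG ∈ L²`, and a divergence-free `b ∈ C¹` bounded with
  bounded derivative (coordinatewise `2∫ bᵢ G ∂ᵢG = −∫ G² ∂ᵢbᵢ`, summed);
* `integral_mul_laplacian_eq_neg` — `∫ G ΔG = −∫ |∇G|²` (`G, ∂ᵢG, ∂ᵢ∂ᵢG ∈ L²`);
* `integral_energy_eq_of_drift_laplacian` / `integral_energy_le_of_drift_laplacian` — for any
  scalar `G ∈ C²` obeying pointwise `G' + DG[b] = ν (ΔG + 2 radDerivQuot G) + R`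
  (`2 radDerivQuot G = (2/r)∂ᵣG`):
  `∫ G G' + ν ∫ |∇G|² = 2ν ∫ G · radDerivQuot G + ∫ G R`, and, `G` being axisymmetric and `ν ≥ 0`,
  `∫ G G' + ν ∫ |∇G|² ≤ ∫ G R` by the axis-term sign lemma
  `IsAxisymmetricScalar.integral_mul_radDerivQuot_nonpos` (`∫ G radDerivQuot G = −(c₂/2)∫G(0,0,z)²dz ≤ 0`,
  `HouLeiLiEstimate.lean`);
* `IsClassicalNSSolutionOn.angVortQuot_energy_le` — **the `Ω`-inequality** for a classical
  axisymmetric solution at a time `t ∈ S`: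
  `∫ Ω Ω' + ν ∫ |∇Ω|² ≤ −2 ∫ Ω Φ J`, `Ω = angVortQuot (u t)`, `Ω' = angVortQuot (∂ₜu t)`,
  `Φ = angVelQuot (u t) = v^θ/r`, `J = radVelQuot (curl (u t)) = ωʳ/r`, from the pointwise
  equation `IsClassicalNSSolutionOn.angVortQuot_eq`.

The same two generic lemmas serve the `J`- and `Φ`-equations (sequel files). The
square-integrability hypotheses hold at every time for solutions in Tao's class
(`RadialQuotientSobolev.lean`, `RadialQuotientDerivatives.lean`).

## Mathlib / tree search

Tree: `IsClassicalNSSolutionOn.angVortQuot_eq` (`AxisymQuotientEquationsOmega`),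
`integral_mul_fderiv_fderiv_eq_neg_sq`, `IsAxisymmetricScalar.integral_mul_radDerivQuot_nonpos`
(`HouLeiLiEstimate`), `eq_sum_smul_single` (`AxisymmetricVorticityTransport`),
`divergence_eq_sum_three`, `fderiv_apply_coord_vec3`, `contDiff_apply_coord_vec3`
(`AxisymHouLiVariables`), `laplacian_eq_sum_fderiv_fderiv` (`HessianLaplacian`).
Mathlib: `integral_mul_fderiv_eq_neg_fderiv_mul_of_integrable`, `MemLp.integrable_mul`,
`Integrable.bdd_mul`. `lean search 'integral_mul_fderiv_apply_eq_zero|angVortQuot_energy'`: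
nothing before this file.

## References

* Z. Lei, Q. S. Zhang, Pacific J. Math. 289 (2017) 169–187, arXiv:1505.02628, §3, p. 8
  (energy estimate of `Ω`, axis boundary terms). [`LeiZhang2017`]
* D. Wei, J. Math. Anal. Appl. 435 (2016) 402–413, arXiv:1508.03318, §3 (3.2). [`Wei2016`]
-/

noncomputable section

open MeasureTheory Set Function Filter Topology InnerProductSpace WithLp
open scoped RealInnerProductSpace Laplacian ContDiff ENNReal

namespace Literature.Analysis.FluidPDE

/-! ### Coordinates -/

section Coord

/-- A directional derivative of a scalar in coordinates: `DG(x)[w] = Σⱼ wⱼ ∂ⱼG(x)`. [folklore] -/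
theorem fderiv_apply_eq_sum_three (G : EuclideanSpace ℝ (Fin 3) → ℝ) (x w : EuclideanSpace ℝ (Fin 3)) :
    fderiv ℝ G x w = w 0 * fderiv ℝ G x (EuclideanSpace.single 0 1) +
      w 1 * fderiv ℝ G x (EuclideanSpace.single 1 1) + w 2 * fderiv ℝ G x (EuclideanSpace.single 2 1) := by
  conv_lhs => rw [eq_sum_smul_single w]
  simp only [Fin.sum_univ_three, map_add, map_smul, smul_eq_mul]

end Coord

/-! ### The transport term vanishes -/

section Transport

variable {G : EuclideanSpace ℝ (Fin 3) → ℝ} {b : EuclideanSpace ℝ (Fin 3) → EuclideanSpace ℝ (Fin 3)}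

/-- Per coordinate: `2 ∫ bᵢ G ∂ᵢG = −∫ G² ∂ᵢbᵢ`, by parts (`∂ᵢ(G bᵢ) = ∂ᵢG bᵢ + G ∂ᵢbᵢ`), for
`G ∈ C¹` with `G, ∂ᵢG ∈ L²` and `b ∈ C¹` bounded with bounded derivative. [folklore] -/
theorem two_mul_integral_coord_mul_mul_fderiv (hG : ContDiff ℝ 1 G) (hb : ContDiff ℝ 1 b)
    (h0 : MemLp G 2 volume) (i : Fin 3)
    (h1 : MemLp (fun x => fderiv ℝ G x (EuclideanSpace.single i 1)) 2 volume)
    {B : ℝ} (hbB : ∀ x, ‖b x‖ ≤ B) {B' : ℝ} (hDb : ∀ x, ‖fderiv ℝ b x‖ ≤ B') :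
    2 * ∫ x, b x i * (G x * fderiv ℝ G x (EuclideanSpace.single i 1)) =
      -∫ x, fderiv ℝ b x (EuclideanSpace.single i 1) i * (G x * G x) := by
  set e : EuclideanSpace ℝ (Fin 3) := EuclideanSpace.single i 1 with he
  have hGd : Differentiable ℝ G := hG.differentiable one_ne_zero
  have hbd : Differentiable ℝ b := hb.differentiable one_ne_zero
  have hbi : ContDiff ℝ 1 fun x => b x i := contDiff_apply_coord_vec3 hb i
  have hbid : Differentiable ℝ fun x => b x i := hbi.differentiable one_ne_zero
  have hF : Differentiable ℝ fun x => G x * b x i := hGd.mul hbid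
  -- the derivative of `G bᵢ` along `eᵢ`
  have hDF : ∀ x, fderiv ℝ (fun y => G y * b y i) x e =
      fderiv ℝ G x e * b x i + G x * fderiv ℝ b x e i := by
    intro x
    rw [fderiv_fun_mul (hGd x) (hbid x)]
    simp only [_root_.add_apply, _root_.FunLike.coe_smul, Pi.smul_apply,
      smul_eq_mul, fderiv_apply_coord_vec3 (hbd x) i e]
    ring
  -- bounds and measurability of the bounded factors
  have hbiB : ∀ x, ‖b x i‖ ≤ B := fun x => (PiLp.norm_apply_le (b x) i).trans (hbB x)
  have hDbiB : ∀ x, ‖fderiv ℝ b x e i‖ ≤ B' := fun x => by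
    calc ‖fderiv ℝ b x e i‖ ≤ ‖fderiv ℝ b x e‖ := PiLp.norm_apply_le _ i
      _ ≤ ‖fderiv ℝ b x‖ * ‖e‖ := (fderiv ℝ b x).le_opNorm e
      _ = ‖fderiv ℝ b x‖ := by rw [he]; simp
      _ ≤ B' := hDb x
  have hbim : AEStronglyMeasurable (fun x => b x i) volume := hbid.continuous.aestronglyMeasurable
  have hDbc : ContDiff ℝ 0 fun x => fderiv ℝ b x e :=
    contDiff_zero.2 ((hb.continuous_fderiv one_ne_zero).clm_apply continuous_const)
  have hDbim : AEStronglyMeasurable (fun x => fderiv ℝ b x e i) volume :=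
    (contDiff_apply_coord_vec3 hDbc i).continuous.aestronglyMeasurable
  -- integrable pieces
  have i1 : Integrable (fun x => G x * fderiv ℝ G x e) volume := h0.integrable_mul h1
  have i2 : Integrable (fun x => G x * G x) volume := h0.integrable_mul h0
  have iA : Integrable (fun x => b x i * (G x * fderiv ℝ G x e)) volume :=
    i1.bdd_mul hbim (ae_of_all _ hbiB)
  have iB : Integrable (fun x => fderiv ℝ b x e i * (G x * G x)) volume :=
    i2.bdd_mul hDbim (ae_of_all _ hDbiB)
  -- by parts
  have hibp := integral_mul_fderiv_eq_neg_fderiv_mul_of_integrable (μ := volume)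
    (f := fun x => G x * b x i) (g := G) (v := e) ?_ ?_ ?_ (fun x _ => hF x) (fun x _ => hGd x)
  rotate_left
  · have iAB : Integrable (fun x => b x i * (G x * fderiv ℝ G x e) + fderiv ℝ b x e i * (G x * G x))
        volume := iA.add iB
    refine iAB.congr (Eventually.of_forall fun x => ?_)
    beta_reduce
    rw [hDF x]
    ring
  · exact iA.congr (Eventually.of_forall fun x => by simp only; ring)
  · exact (i2.bdd_mul hbim (ae_of_all _ hbiB)).congr (Eventually.of_forall fun x => by
      simp only; ring)
  have hL : ∫ x, G x * b x i * fderiv ℝ G x e = ∫ x, b x i * (G x * fderiv ℝ G x e) :=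
    integral_congr_ae (Eventually.of_forall fun x => by simp only; ring)
  have hR : ∫ x, fderiv ℝ (fun y => G y * b y i) x e * G x =
      (∫ x, b x i * (G x * fderiv ℝ G x e)) + ∫ x, fderiv ℝ b x e i * (G x * G x) := by
    rw [← integral_add iA iB]
    refine integral_congr_ae (Eventually.of_forall fun x => ?_)
    simp only
    rw [hDF x]
    ring
  rw [hL, hR] at hibp
  linarith

/-- **The transport term vanishes**: `∫ G · DG[b] = 0` for `G ∈ C¹` with `G, ∂ᵢG ∈ L²` and a
divergence-free `b ∈ C¹` that is bounded with bounded derivative (Lei–Zhang: "`b` is divergence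
free"; `∫ G DG[b] = ½ ∫ div (G² b) = 0`). [cite: LeiZhang2017, §3 (p. 8)] -/
theorem integral_mul_fderiv_apply_eq_zero_of_isDivFree (hG : ContDiff ℝ 1 G) (hb : ContDiff ℝ 1 b)
    (hdiv : VectorCalculus.IsDivFree b) (h0 : MemLp G 2 volume)
    (h1 : ∀ i : Fin 3, MemLp (fun x => fderiv ℝ G x (EuclideanSpace.single i 1)) 2 volume)
    {B : ℝ} (hbB : ∀ x, ‖b x‖ ≤ B) {B' : ℝ} (hDb : ∀ x, ‖fderiv ℝ b x‖ ≤ B') :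
    ∫ x, G x * fderiv ℝ G x (b x) = 0 := by
  have hS := fun i => two_mul_integral_coord_mul_mul_fderiv hG hb h0 i (h1 i) hbB hDb
  have hbid : ∀ i : Fin 3, Differentiable ℝ fun x => b x i := fun i =>
    (contDiff_apply_coord_vec3 hb i).differentiable one_ne_zero
  have hbiB : ∀ (i : Fin 3) x, ‖b x i‖ ≤ B := fun i x => (PiLp.norm_apply_le (b x) i).trans (hbB x)
  have iA : ∀ i : Fin 3, Integrable
      (fun x => b x i * (G x * fderiv ℝ G x (EuclideanSpace.single i 1))) volume := fun i =>
    (h0.integrable_mul (h1 i)).bdd_mul (hbid i).continuous.aestronglyMeasurable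
      (ae_of_all _ (hbiB i))
  have hDbc : ∀ i : Fin 3, ContDiff ℝ 0 fun x => fderiv ℝ b x (EuclideanSpace.single i 1) := fun i =>
    contDiff_zero.2 ((hb.continuous_fderiv one_ne_zero).clm_apply continuous_const)
  have hDbiB : ∀ (i : Fin 3) x, ‖fderiv ℝ b x (EuclideanSpace.single i 1) i‖ ≤ B' := fun i x => by
    calc ‖fderiv ℝ b x (EuclideanSpace.single i 1) i‖
        ≤ ‖fderiv ℝ b x (EuclideanSpace.single i 1)‖ := PiLp.norm_apply_le _ i
      _ ≤ ‖fderiv ℝ b x‖ * ‖(EuclideanSpace.single i 1 : EuclideanSpace ℝ (Fin 3))‖ :=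
          (fderiv ℝ b x).le_opNorm _
      _ = ‖fderiv ℝ b x‖ := by simp
      _ ≤ B' := hDb x
  have iB : ∀ i : Fin 3, Integrable
      (fun x => fderiv ℝ b x (EuclideanSpace.single i 1) i * (G x * G x)) volume := fun i =>
    (h0.integrable_mul h0).bdd_mul (contDiff_apply_coord_vec3 (hDbc i) i).continuous.aestronglyMeasurable
      (ae_of_all _ (hDbiB i))
  -- `Σᵢ ∫ G² ∂ᵢbᵢ = ∫ G² div b = 0`
  have hdivint : (∫ x, fderiv ℝ b x (EuclideanSpace.single 0 1) 0 * (G x * G x)) +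
      (∫ x, fderiv ℝ b x (EuclideanSpace.single 1 1) 1 * (G x * G x)) +
      (∫ x, fderiv ℝ b x (EuclideanSpace.single 2 1) 2 * (G x * G x)) = 0 := by
    have iB01 : Integrable (fun x => fderiv ℝ b x (EuclideanSpace.single 0 1) 0 * (G x * G x) +
        fderiv ℝ b x (EuclideanSpace.single 1 1) 1 * (G x * G x)) volume := (iB 0).add (iB 1)
    rw [← integral_add (iB 0) (iB 1), ← integral_add iB01 (iB 2)]
    refine integral_eq_zero_of_ae (Eventually.of_forall fun x => ?_)
    have h := divergence_eq_sum_three b x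
    rw [hdiv x] at h
    simp only [Pi.zero_apply]
    have : fderiv ℝ b x (EuclideanSpace.single 0 1) 0 + fderiv ℝ b x (EuclideanSpace.single 1 1) 1 +
        fderiv ℝ b x (EuclideanSpace.single 2 1) 2 = 0 := h.symm
    calc fderiv ℝ b x (EuclideanSpace.single 0 1) 0 * (G x * G x) +
          fderiv ℝ b x (EuclideanSpace.single 1 1) 1 * (G x * G x) +
          fderiv ℝ b x (EuclideanSpace.single 2 1) 2 * (G x * G x)
        = (fderiv ℝ b x (EuclideanSpace.single 0 1) 0 + fderiv ℝ b x (EuclideanSpace.single 1 1) 1 +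
            fderiv ℝ b x (EuclideanSpace.single 2 1) 2) * (G x * G x) := by ring
      _ = 0 := by rw [this, zero_mul]
  -- `∫ G DG[b] = Σᵢ ∫ bᵢ G ∂ᵢG`
  have hsplit : ∫ x, G x * fderiv ℝ G x (b x) =
      (∫ x, b x 0 * (G x * fderiv ℝ G x (EuclideanSpace.single 0 1))) +
      (∫ x, b x 1 * (G x * fderiv ℝ G x (EuclideanSpace.single 1 1))) +
      (∫ x, b x 2 * (G x * fderiv ℝ G x (EuclideanSpace.single 2 1))) := by
    have iA01 : Integrable (fun x => b x 0 * (G x * fderiv ℝ G x (EuclideanSpace.single 0 1)) +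
        b x 1 * (G x * fderiv ℝ G x (EuclideanSpace.single 1 1))) volume := (iA 0).add (iA 1)
    rw [← integral_add (iA 0) (iA 1), ← integral_add iA01 (iA 2)]
    refine integral_congr_ae (Eventually.of_forall fun x => ?_)
    beta_reduce
    rw [fderiv_apply_eq_sum_three G x (b x)]
    ring
  have h0' := hS 0
  have h1' := hS 1
  have h2' := hS 2
  rw [hsplit]
  linarith

end Transport

/-! ### `∫ G ΔG = −∫ |∇G|²` -/

section Laplace

variable {G : EuclideanSpace ℝ (Fin 3) → ℝ}

/-- **`∫ G ΔG = −∫ |∇G|²`** on `ℝ³` for `G ∈ C²` with `G, ∂ᵢG, ∂ᵢ∂ᵢG ∈ L²` (three whole-space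
integrations by parts, `integral_mul_fderiv_fderiv_eq_neg_sq`). [folklore] -/
theorem integral_mul_laplacian_eq_neg (hG : ContDiff ℝ 2 G) (h0 : MemLp G 2 volume)
    (h1 : ∀ i : Fin 3, MemLp (fun x => fderiv ℝ G x (EuclideanSpace.single i 1)) 2 volume)
    (h2 : ∀ i : Fin 3, MemLp (fun x => fderiv ℝ (fun y => fderiv ℝ G y (EuclideanSpace.single i 1)) x
      (EuclideanSpace.single i 1)) 2 volume) :
    ∫ x, G x * (Δ G) x = -∫ x, (fderiv ℝ G x (EuclideanSpace.single 0 1) ^ 2 +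
      fderiv ℝ G x (EuclideanSpace.single 1 1) ^ 2 + fderiv ℝ G x (EuclideanSpace.single 2 1) ^ 2) := by
  have hI := fun i : Fin 3 => integral_mul_fderiv_fderiv_eq_neg_sq hG (EuclideanSpace.single i 1) h0 (h1 i) (h2 i)
  have iJ : ∀ i : Fin 3, Integrable (fun x => G x *
      fderiv ℝ (fun y => fderiv ℝ G y (EuclideanSpace.single i 1)) x (EuclideanSpace.single i 1)) volume :=
    fun i => h0.integrable_mul (h2 i)
  have iS : ∀ i : Fin 3, Integrable (fun x => fderiv ℝ G x (EuclideanSpace.single i 1) ^ 2) volume :=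
    fun i => (h1 i).integrable_sq
  have hlap : ∀ x, G x * (Δ G) x =
      G x * fderiv ℝ (fun y => fderiv ℝ G y (EuclideanSpace.single 0 1)) x (EuclideanSpace.single 0 1) +
      G x * fderiv ℝ (fun y => fderiv ℝ G y (EuclideanSpace.single 1 1)) x (EuclideanSpace.single 1 1) +
      G x * fderiv ℝ (fun y => fderiv ℝ G y (EuclideanSpace.single 2 1)) x (EuclideanSpace.single 2 1) := by
    intro x
    rw [laplacian_eq_sum_fderiv_fderiv (EuclideanSpace.basisFun (Fin 3) ℝ) hG x]
    simp only [EuclideanSpace.basisFun_apply, Fin.sum_univ_three]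
    ring
  have iJ01 : Integrable (fun x =>
      G x * fderiv ℝ (fun y => fderiv ℝ G y (EuclideanSpace.single 0 1)) x (EuclideanSpace.single 0 1) +
      G x * fderiv ℝ (fun y => fderiv ℝ G y (EuclideanSpace.single 1 1)) x (EuclideanSpace.single 1 1))
      volume := (iJ 0).add (iJ 1)
  have iS01 : Integrable (fun x => fderiv ℝ G x (EuclideanSpace.single 0 1) ^ 2 +
      fderiv ℝ G x (EuclideanSpace.single 1 1) ^ 2) volume := (iS 0).add (iS 1)
  rw [integral_congr_ae (Eventually.of_forall hlap), integral_add iJ01 (iJ 2),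
    integral_add (iJ 0) (iJ 1), hI 0, hI 1, hI 2, integral_add iS01 (iS 2),
    integral_add (iS 0) (iS 1)]
  ring

end Laplace

/-! ### The energy identity for a drift–Laplace equation with the axis term -/

section Energy

variable {G G' R : EuclideanSpace ℝ (Fin 3) → ℝ} {b : EuclideanSpace ℝ (Fin 3) → EuclideanSpace ℝ (Fin 3)}
  {ν : ℝ}

/-- **Energy identity.** If `G ∈ C²` satisfies pointwise `G' + DG[b] = ν (ΔG + 2 radDerivQuot G) + R`
on `ℝ³` with `G, ∂ᵢG, ∂ᵢ∂ᵢG, radDerivQuot G ∈ L²`, `G R` integrable, and `b ∈ C¹`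
divergence-free, bounded with bounded derivative, then
`∫ G G' + ν ∫ |∇G|² = 2ν ∫ G radDerivQuot G + ∫ G R`
(pairing with `G`: the transport term vanishes and `∫ G ΔG = −∫|∇G|²`). This is the computation
behind Lei–Zhang's (3.1)–(3.3) with the axis term `2ν∫ G (∂ᵣG)/r = −ν c₂ ∫ G(0,0,z)² dz` kept
explicit. [cite: LeiZhang2017, §3 (p. 8)] -/
theorem integral_energy_eq_of_drift_laplacian (hG : ContDiff ℝ 2 G) (h0 : MemLp G 2 volume)
    (h1 : ∀ i : Fin 3, MemLp (fun x => fderiv ℝ G x (EuclideanSpace.single i 1)) 2 volume)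
    (h2 : ∀ i : Fin 3, MemLp (fun x => fderiv ℝ (fun y => fderiv ℝ G y (EuclideanSpace.single i 1)) x
      (EuclideanSpace.single i 1)) 2 volume)
    (hq : MemLp (radDerivQuot G) 2 volume)
    (hR : Integrable (fun x => G x * R x) volume)
    (hb : ContDiff ℝ 1 b) (hdiv : VectorCalculus.IsDivFree b)
    {B : ℝ} (hbB : ∀ x, ‖b x‖ ≤ B) {B' : ℝ} (hDb : ∀ x, ‖fderiv ℝ b x‖ ≤ B')
    (heq : ∀ x, G' x + fderiv ℝ G x (b x) = ν * ((Δ G) x + 2 * radDerivQuot G x) + R x) :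
    (∫ x, G x * G' x) + ν * ∫ x, (fderiv ℝ G x (EuclideanSpace.single 0 1) ^ 2 +
        fderiv ℝ G x (EuclideanSpace.single 1 1) ^ 2 + fderiv ℝ G x (EuclideanSpace.single 2 1) ^ 2) =
      2 * ν * (∫ x, G x * radDerivQuot G x) + ∫ x, G x * R x := by
  have hG1 : ContDiff ℝ 1 G := hG.of_le (by norm_num)
  have htr := integral_mul_fderiv_apply_eq_zero_of_isDivFree hG1 hb hdiv h0 h1 hbB hDb
  have hlap := integral_mul_laplacian_eq_neg hG h0 h1 h2
  -- integrability of `G ΔG`, `G q_G`, `G DG[b]`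
  have iJ : ∀ i : Fin 3, Integrable (fun x => G x *
      fderiv ℝ (fun y => fderiv ℝ G y (EuclideanSpace.single i 1)) x (EuclideanSpace.single i 1)) volume :=
    fun i => h0.integrable_mul (h2 i)
  have iL : Integrable (fun x => G x * (Δ G) x) volume := by
    have i3 : Integrable (fun x =>
        G x * fderiv ℝ (fun y => fderiv ℝ G y (EuclideanSpace.single 0 1)) x (EuclideanSpace.single 0 1) +
        G x * fderiv ℝ (fun y => fderiv ℝ G y (EuclideanSpace.single 1 1)) x (EuclideanSpace.single 1 1) +
        G x * fderiv ℝ (fun y => fderiv ℝ G y (EuclideanSpace.single 2 1)) x (EuclideanSpace.single 2 1))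
        volume := ((iJ 0).add (iJ 1)).add (iJ 2)
    refine i3.congr (Eventually.of_forall fun x => ?_)
    beta_reduce
    rw [laplacian_eq_sum_fderiv_fderiv (EuclideanSpace.basisFun (Fin 3) ℝ) hG x]
    simp only [EuclideanSpace.basisFun_apply, Fin.sum_univ_three]
    ring
  have iQ : Integrable (fun x => G x * radDerivQuot G x) volume := h0.integrable_mul hq
  have hbid : ∀ i : Fin 3, Differentiable ℝ fun x => b x i := fun i =>
    (contDiff_apply_coord_vec3 hb i).differentiable one_ne_zero
  have hbiB : ∀ (i : Fin 3) x, ‖b x i‖ ≤ B := fun i x => (PiLp.norm_apply_le (b x) i).trans (hbB x)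
  have iA : ∀ i : Fin 3, Integrable
      (fun x => b x i * (G x * fderiv ℝ G x (EuclideanSpace.single i 1))) volume := fun i =>
    (h0.integrable_mul (h1 i)).bdd_mul (hbid i).continuous.aestronglyMeasurable
      (ae_of_all _ (hbiB i))
  have iT : Integrable (fun x => G x * fderiv ℝ G x (b x)) volume := by
    have i3 : Integrable (fun x => b x 0 * (G x * fderiv ℝ G x (EuclideanSpace.single 0 1)) +
        b x 1 * (G x * fderiv ℝ G x (EuclideanSpace.single 1 1)) +
        b x 2 * (G x * fderiv ℝ G x (EuclideanSpace.single 2 1))) volume := ((iA 0).add (iA 1)).add (iA 2)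
    refine i3.congr (Eventually.of_forall fun x => ?_)
    beta_reduce
    rw [fderiv_apply_eq_sum_three G x (b x)]
    ring
  -- integrate `G ×` the equation
  have hpt : ∀ x, G x * G' x =
      -(G x * fderiv ℝ G x (b x)) + ν * (G x * (Δ G) x) + 2 * ν * (G x * radDerivQuot G x) +
        G x * R x := by
    intro x
    have h := heq x
    have : G' x = -fderiv ℝ G x (b x) + ν * ((Δ G) x + 2 * radDerivQuot G x) + R x := by linarith
    rw [this]
    ring
  have iTn : Integrable (fun x => -(G x * fderiv ℝ G x (b x))) volume := iT.neg
  have iLν : Integrable (fun x => ν * (G x * (Δ G) x)) volume := iL.const_mul ν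
  have iQν : Integrable (fun x => 2 * ν * (G x * radDerivQuot G x)) volume := iQ.const_mul (2 * ν)
  have i12 : Integrable (fun x => -(G x * fderiv ℝ G x (b x)) + ν * (G x * (Δ G) x)) volume :=
    iTn.add iLν
  have i123 : Integrable (fun x => -(G x * fderiv ℝ G x (b x)) + ν * (G x * (Δ G) x) +
      2 * ν * (G x * radDerivQuot G x)) volume := i12.add iQν
  have hint : ∫ x, G x * G' x =
      -(∫ x, G x * fderiv ℝ G x (b x)) + ν * (∫ x, G x * (Δ G) x) +
        2 * ν * (∫ x, G x * radDerivQuot G x) + ∫ x, G x * R x := by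
    rw [integral_congr_ae (Eventually.of_forall hpt), integral_add i123 hR, integral_add i12 iQν,
      integral_add iTn iLν, integral_neg, integral_const_mul, integral_const_mul]
  rw [hint, htr, hlap]
  ring

/-- **Energy inequality.** Under the hypotheses of `integral_energy_eq_of_drift_laplacian`, if
moreover `G` is axisymmetric and `ν ≥ 0`, then `∫ G G' + ν ∫ |∇G|² ≤ ∫ G R`: the axis term
`2ν ∫ G radDerivQuot G = −ν c₂ ∫ G(0,0,z)² dz` is `≤ 0`
(`IsAxisymmetricScalar.integral_mul_radDerivQuot_nonpos`). [cite: LeiZhang2017, §3 (p. 8)] -/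
theorem integral_energy_le_of_drift_laplacian (hG : ContDiff ℝ 2 G) (hax : IsAxisymmetricScalar G)
    (hν : 0 ≤ ν) (h0 : MemLp G 2 volume)
    (h1 : ∀ i : Fin 3, MemLp (fun x => fderiv ℝ G x (EuclideanSpace.single i 1)) 2 volume)
    (h2 : ∀ i : Fin 3, MemLp (fun x => fderiv ℝ (fun y => fderiv ℝ G y (EuclideanSpace.single i 1)) x
      (EuclideanSpace.single i 1)) 2 volume)
    (hq : MemLp (radDerivQuot G) 2 volume)
    (hR : Integrable (fun x => G x * R x) volume)
    (hb : ContDiff ℝ 1 b) (hdiv : VectorCalculus.IsDivFree b)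
    {B : ℝ} (hbB : ∀ x, ‖b x‖ ≤ B) {B' : ℝ} (hDb : ∀ x, ‖fderiv ℝ b x‖ ≤ B')
    (heq : ∀ x, G' x + fderiv ℝ G x (b x) = ν * ((Δ G) x + 2 * radDerivQuot G x) + R x) :
    (∫ x, G x * G' x) + ν * ∫ x, (fderiv ℝ G x (EuclideanSpace.single 0 1) ^ 2 +
        fderiv ℝ G x (EuclideanSpace.single 1 1) ^ 2 + fderiv ℝ G x (EuclideanSpace.single 2 1) ^ 2) ≤
      ∫ x, G x * R x := by
  rw [integral_energy_eq_of_drift_laplacian hG h0 h1 h2 hq hR hb hdiv hbB hDb heq]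
  have hax' := hax.integral_mul_radDerivQuot_nonpos hG h0 hq
  nlinarith [mul_nonpos_iff.2 (Or.inl ⟨hν, hax'⟩)]

end Energy

/-! ### The `Ω`-inequality for axisymmetric Navier–Stokes solutions -/

section Omega

variable {S : Set ℝ} {ν : ℝ} {v : ℝ → EuclideanSpace ℝ (Fin 3) → EuclideanSpace ℝ (Fin 3)}
  {q : ℝ → EuclideanSpace ℝ (Fin 3) → ℝ}

/-- **The `L²` energy inequality of `Ω = ω^θ/r`** (Lei–Zhang 2017, §3, p. 8, the `Ω`-part of
(3.1)–(3.3); Wei 2016, (3.2)). Let `(v, q)` be a classical solution of the unforced Navier–Stokes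
system with viscosity `ν ≥ 0` on a time set `S ⊆ closure (interior S)` of unique
differentiability, with axisymmetric velocity, and let `t ∈ S`. Write `Ω = angVortQuot (v t)`,
`Ω' = angVortQuot (∂ₜv t)` (`∂ₜ` the derivative within `S`), `Φ = angVelQuot (v t) = v^θ/r`,
`J = radVelQuot (curl (v t)) = ωʳ/r`. If `Ω, ∂ᵢΩ, ∂ᵢ∂ᵢΩ, radDerivQuot Ω ∈ L²`, `Ω Φ J` is
integrable and `v t` is bounded with bounded derivative, then (`Ω Ω'` is then integrable too)
`∫ Ω Ω' + ν ∫ |∇Ω|² ≤ −2 ∫ Ω Φ J`. [cite: LeiZhang2017, §3 (p. 8)] -/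
theorem IsClassicalNSSolutionOn.angVortQuot_energy_le (hns : IsClassicalNSSolutionOn S ν 0 v q)
    (hS : UniqueDiffOn ℝ S) (hcl : S ⊆ closure (interior S))
    (hax : ∀ s ∈ S, IsAxisymmetric (v s)) (hν : 0 ≤ ν) {t : ℝ} (ht : t ∈ S)
    (h0 : MemLp (angVortQuot (v t)) 2 volume)
    (h1 : ∀ i : Fin 3, MemLp (fun x => fderiv ℝ (angVortQuot (v t)) x (EuclideanSpace.single i 1)) 2 volume)
    (h2 : ∀ i : Fin 3, MemLp (fun x => fderiv ℝ (fun y => fderiv ℝ (angVortQuot (v t)) y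
      (EuclideanSpace.single i 1)) x (EuclideanSpace.single i 1)) 2 volume)
    (hq : MemLp (radDerivQuot (angVortQuot (v t))) 2 volume)
    (hR : Integrable (fun x => angVortQuot (v t) x *
      (angVelQuot (v t) x * radVelQuot (curl (v t)) x)) volume)
    {B : ℝ} (hbB : ∀ x, ‖v t x‖ ≤ B) {B' : ℝ} (hDb : ∀ x, ‖fderiv ℝ (v t) x‖ ≤ B') :
    (∫ x, angVortQuot (v t) x * angVortQuot (timeDerivWithin S v t) x) +
      ν * ∫ x, (fderiv ℝ (angVortQuot (v t)) x (EuclideanSpace.single 0 1) ^ 2 +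
        fderiv ℝ (angVortQuot (v t)) x (EuclideanSpace.single 1 1) ^ 2 +
        fderiv ℝ (angVortQuot (v t)) x (EuclideanSpace.single 2 1) ^ 2) ≤
      -2 * ∫ x, angVortQuot (v t) x * (angVelQuot (v t) x * radVelQuot (curl (v t)) x) := by
  have hv : ContDiff ℝ ∞ (v t) := hns.contDiff_velocity ht
  have hv1 : ContDiff ℝ 1 (v t) := hv.of_le (by norm_cast)
  have hv3 : ContDiff ℝ 3 (v t) := hv.of_le (by norm_cast)
  have hΩ2 : ContDiff ℝ 2 (angVortQuot (v t)) :=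
    contDiff_angVortQuot (n := 2) (by exact_mod_cast hv.of_le (by norm_cast))
  have hΩax : IsAxisymmetricScalar (angVortQuot (v t)) := (hax t ht).isAxisymmetricScalar_angVortQuot hv3
  have heq : ∀ x, angVortQuot (timeDerivWithin S v t) x + fderiv ℝ (angVortQuot (v t)) x (v t x) =
      ν * ((Δ (angVortQuot (v t))) x + 2 * radDerivQuot (angVortQuot (v t)) x) +
        (-2) * (angVelQuot (v t) x * radVelQuot (curl (v t)) x) := fun x => by
    rw [hns.angVortQuot_eq hS hcl hax ht x]
    ring
  have hR' : Integrable (fun x => angVortQuot (v t) x *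
      ((-2) * (angVelQuot (v t) x * radVelQuot (curl (v t)) x))) volume :=
    (hR.const_mul (-2)).congr (Eventually.of_forall fun x => by simp only; ring)
  have h := integral_energy_le_of_drift_laplacian hΩ2 hΩax hν h0 h1 h2 hq hR' hv1
    (hns.divFree t ht) hbB hDb heq
  have hrw : ∫ x, angVortQuot (v t) x * ((-2) * (angVelQuot (v t) x * radVelQuot (curl (v t)) x)) =
      -2 * ∫ x, angVortQuot (v t) x * (angVelQuot (v t) x * radVelQuot (curl (v t)) x) := by
    rw [← integral_const_mul]
    exact integral_congr_ae (Eventually.of_forall fun x => by simp only; ring)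
  rwa [hrw] at h

end Omega

end Literature.Analysis.FluidPDE
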